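import Mathlib
import HarnessLib.Audit
import Summits.PneNP.PneNP.Theorems.PstarSlackOneCentre

/-!
# The census node past slack one: `TerminalFive` from O2 and the joint menu criterion on structures with `t ≥ 2` or disconnected (ROUND-24, O1; memo g25 §46)

FRONTIER range-avoidance ladder, rung F-N3, ROUND 24 (cell `pnp-ideate`, prover-2 memo `g25/O1-XORSPLIT-g25.md` §46; typed targets
`PstarCoreBoundTargets.TerminalFive` / `TerminalPeelable` (p646951); restricted-model proof complexity — nothing here bears on `P` versus `NP`).

`PstarMenuCriterion.terminalFive_of_menuBound` derives `TerminalFive` from O2 (`TerminalFiveA`) and the census node `MenuCriterionBound`, which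
must certify EVERY terminal core with a centre.  With `PstarMaxSharingCentre.no_centre_at_max_sharing` (slack `0`) and
`PstarSlackOneCentre.no_centre_at_slack_one` (slack `1`) the X-connected structures of boundary slack `t = 2·#bdry − 3·#K ≤ 1` carry no centre
inside the induction, for every sharing pattern.  This file makes those theorems load-bearing:

* `two_mul_card_le_card_bdry_add` — `2·#K ≤ #bdry K + #sharedSlots K` (pure: non-shared AND slots hold distinct boundary variables), so with
  `PstarSharingBound.card_bdry_add_card_sharedSlots_le` the count is exact and **`no_centre_at_slack_zero`** restates the max-sharing theorem through
  the boundary: `2·#bdry K = 3·#K` ⟹ no centre (X-connected, inside the induction);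
* `MenuCriterionBoundSlackTwo` (OPEN, census-type) — `MenuCriterionBound` restricted to the cores that are NOT X-connected or have slack `≥ 2`
  (`3·#K + 2 ≤ 2·#bdry K`); `menuCriterionBoundSlackTwo_of_menuCriterionBound` (weaker node);
* **`terminalFive_of_menuBoundSlackTwo : TerminalFiveA → MenuCriterionBoundSlackTwo → TerminalFive`** and `terminalPeelable_of_menuBoundSlackTwo`
  — the strong induction of `terminalFive_of_menuBound` with the two slack layers discharged by name.
-/

set_option linter.dupNamespace false -- `Summit.PneNP.PneNP.…`: summit = sub-problem name (D-0017 single-conjunct layout)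

open Finset Literature.Computability.Complexity
open Summit.PneNP.PneNP.Theorems.PstarTyped (Typed)
open Summit.PneNP.PneNP.Theorems.PstarSALevel (varSet bdry BoundaryExpanding SimpleOverlap)
open Summit.PneNP.PneNP.Theorems.PstarSAClosure (degIn mem_bdry_iff)
open Summit.PneNP.PneNP.Theorems.PstarXCore (xverts)
open Summit.PneNP.PneNP.Theorems.PstarCoreBound (XorClosed)
open Summit.PneNP.PneNP.Theorems.PstarChordRepair (IsChord)
open Summit.PneNP.PneNP.Theorems.PstarCoreBoundTargets (Terminal TerminalFive TerminalFiveA TerminalPeelable nonchords nonchords_subset mem_nonchords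
  terminalPeelable_of_terminalFive)
open Summit.PneNP.PneNP.Theorems.PstarSharingBound (mult andSlots sharedSlots card_andSlots sharedSlots_subset card_bdry_add_card_sharedSlots_le)
open Summit.PneNP.PneNP.Theorems.PstarChordBridgeTools (xpdeg)
open Summit.PneNP.PneNP.Theorems.PstarChordBridgeCentre (exists_maximal_peelable_sup)
open Summit.PneNP.PneNP.Theorems.PstarChordReadOutside (OutsideGated)
open Summit.PneNP.PneNP.Theorems.PstarSliceGenericCriterion (NoShortCoincidence)
open Summit.PneNP.PneNP.Theorems.PstarCleanChordCount (exists_clean_chords)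
open Summit.PneNP.PneNP.Theorems.PstarTerminalPeelableTwelve (exists_centre_of_not_peelable)
open Summit.PneNP.PneNP.Theorems.PstarNoFreeVertex (Covered covered_of_terminal)
open Summit.PneNP.PneNP.Theorems.PstarHangingForest (Anchored anchored_of_terminal)
open Summit.PneNP.PneNP.Theorems.PstarCleanCut (smallCriterion_of_crossing)
open Summit.PneNP.PneNP.Theorems.PstarCleanCutAssembly (false_of_cleanCut_two SkConnected NoTwoCrossings)
open Summit.PneNP.PneNP.Theorems.PstarTwoCleanExact (MenuGeneric false_of_two_clean_exact)
open Summit.PneNP.PneNP.Theorems.PstarMenuCriterion (NoSmallPathSumSubcoreExact channelMenus subset_of_mem_channelMenus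
  noSmallPathSumSubcoreExact_of_subset noShortCoincidence_anti menuGeneric_of_criterion MenuCriterionBound)
open Summit.PneNP.PneNP.Theorems.PstarSkeletonSpan (XConnected)
open Summit.PneNP.PneNP.Theorems.PstarMaxSharingCentre (no_centre_at_max_sharing)
open Summit.PneNP.PneNP.Theorems.PstarSlackOneCentre (no_centre_at_slack_one)

namespace Summit.PneNP.PneNP.Theorems.PstarSlackAssembly

variable {n m : ℕ}

/-! ## The boundary count is exact -/

/-- **`2·#K ≤ #bdry K + #sharedSlots K`** on a pure instance: the non-shared AND slots of `K` hold pairwise distinct boundary variables. -/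
theorem two_mul_card_le_card_bdry_add (I : LocalMap 4 n m) (hI : I.IsPure xorAndPred) (K : Finset (Fin m)) :
    2 * K.card ≤ (bdry I K).card + (sharedSlots I K).card := by
  classical
  have hsplit : (andSlots K \ sharedSlots I K).card + (sharedSlots I K).card = (andSlots K).card :=
    card_sdiff_add_card_eq_card (sharedSlots_subset I K)
  rw [card_andSlots] at hsplit
  -- non-shared AND slots inject into the boundary
  have hinj : (andSlots K \ sharedSlots I K).card ≤ (bdry I K).card := by
    refine card_le_card_of_injOn (fun p => I.vars p.1 p.2) (fun p hp => ?_) ?_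
    · have hp' : p ∈ andSlots K \ sharedSlots I K := mem_coe.1 hp
      obtain ⟨hpA, hpS⟩ := mem_sdiff.1 hp'
      have hfK : p.1 ∈ K := (mem_product.1 hpA).1
      show I.vars p.1 p.2 ∈ ((bdry I K : Finset (Fin n)) : Set (Fin n))
      rw [mem_coe, mem_bdry_iff]
      have hlt : mult I K (I.vars p.1 p.2) < 2 := by
        by_contra h
        exact hpS (mem_filter.2 ⟨hpA, not_lt.1 h⟩)
      have hpos : 0 < mult I K (I.vars p.1 p.2) := by
        unfold PstarSharingBound.mult
        exact card_pos.2 ⟨p.1, mem_filter.2 ⟨hfK, PstarCentreFree.vars_mem_varSet I p.1 p.2⟩⟩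
      unfold PstarSharingBound.mult at hlt hpos
      unfold PstarSAClosure.degIn
      omega
    · intro p hp p' hp' heq
      have hpm : p ∈ andSlots K \ sharedSlots I K := mem_coe.1 hp
      have hpm' : p' ∈ andSlots K \ sharedSlots I K := mem_coe.1 hp'
      obtain ⟨hpA, hpS⟩ := mem_sdiff.1 hpm
      obtain ⟨hpA', -⟩ := mem_sdiff.1 hpm'
      have hfK : p.1 ∈ K := (mem_product.1 hpA).1
      have hfK' : p'.1 ∈ K := (mem_product.1 hpA').1
      change I.vars p.1 p.2 = I.vars p'.1 p'.2 at heq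
      -- same member: otherwise the variable has multiplicity `≥ 2`
      have hff : p.1 = p'.1 := by
        by_contra hne
        apply hpS
        refine mem_filter.2 ⟨hpA, ?_⟩
        unfold PstarSharingBound.mult
        have hsub : ({p.1, p'.1} : Finset (Fin m)) ⊆ K.filter fun j => I.vars p.1 p.2 ∈ varSet I j := by
          intro j hj
          rw [mem_filter]
          rcases mem_insert.1 hj with rfl | hj
          · exact ⟨hfK, PstarCentreFree.vars_mem_varSet I p.1 p.2⟩
          · rw [mem_singleton.1 hj]; exact ⟨hfK', heq ▸ PstarCentreFree.vars_mem_varSet I p'.1 p'.2⟩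
        exact (card_pair hne) ▸ card_le_card hsub
      -- same slot: injective slots
      have hss : p.2 = p'.2 := by
        have h := hI.2 p.1 (show I.vars p.1 p.2 = I.vars p.1 p'.2 by rw [heq, hff])
        exact h
      exact Prod.ext hff hss
  omega

variable {I : LocalMap 4 n m} {r : ℕ} {y : Fin m → Bool} {K : Finset (Fin m)} {w₁ w₂ : Finset (Fin n) × Finset (Fin m) × Bool}

/-- **NO CENTRE AT SLACK ZERO** (`PstarMaxSharingCentre.no_centre_at_max_sharing` through the boundary): inside the induction an X-connected terminal
core with `2·#bdry K = 3·#K` carries no non-empty leafless set of non-chords. -/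
theorem no_centre_at_slack_zero (hI : I.IsPure xorAndPred) (hT : Typed I) (hS : SimpleOverlap I) (hB : BoundaryExpanding r I)
    (ht : Terminal I r y K w₁ w₂)
    (hIH : ∀ c ∈ K, ∀ K₀ ⊆ K.erase c, ∀ d d' : Finset (Fin n) × Finset (Fin m) × Bool, Terminal I r y K₀ d d' → K₀.card ≤ 5)
    (hconn : XConnected I K) (hslack : 2 * (bdry I K).card = 3 * K.card) :
    ¬ ∃ S ⊆ K, S.Nonempty ∧ (∀ w ∈ xverts I S, 2 ≤ xpdeg I S w) ∧ ∀ f ∈ S, ¬ IsChord I K f := by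
  have h1 := card_bdry_add_card_sharedSlots_le I K ht.2.1
  have h2 := two_mul_card_le_card_bdry_add I hI K
  exact no_centre_at_max_sharing hI hT hS hB ht hIH hconn (by omega)

/-! ## The node past slack one and the core bound from it -/

/-- **`MenuCriterionBoundSlackTwo` (OPEN, census-type)**: `PstarMenuCriterion.MenuCriterionBound` restricted to the terminal cores with a centre that
are NOT X-connected or have boundary slack at least two (`3·#J₀ + 2 ≤ 2·#bdry J₀`) — the X-connected structures of slack `0` and `1` carry no centre
(`no_centre_at_slack_zero`, `PstarSlackOneCentre.no_centre_at_slack_one`).  FRONTIER. -/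
@[conjecture] def MenuCriterionBoundSlackTwo : Prop :=
  ∀ (n m r : ℕ) (I : LocalMap 4 n m), I.IsPure xorAndPred → Typed I → SimpleOverlap I → BoundaryExpanding r I →
    ∀ (y : Fin m → Bool) (J₀ : Finset (Fin m)) (w₁ w₂ : Finset (Fin n) × Finset (Fin m) × Bool), Terminal I r y J₀ w₁ w₂ →
      (∃ S ⊆ J₀, S.Nonempty ∧ (∀ w ∈ xverts I S, 2 ≤ xpdeg I S w) ∧ ∀ f ∈ S, ¬ IsChord I J₀ f) →
      Covered I J₀ (w₁.2.1 ∪ w₂.2.1) → Anchored I J₀ (w₁.2.1 ∪ w₂.2.1) → NoTwoCrossings I J₀ (w₁.2.1 ∪ w₂.2.1) →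
      (XConnected I J₀ → 3 * J₀.card + 2 ≤ 2 * (bdry I J₀).card) →
      ∃ ℬ ⊆ J₀, ℬ.card + 2 ≤ (sharedSlots I J₀).card ∧
        ∀ c ∈ J₀, c ∉ ℬ → IsChord I J₀ c → OutsideGated I J₀ (w₁.2.1 ∪ w₂.2.1) c → SkConnected I J₀ (w₁.2.1 ∪ w₂.2.1) c →
          ∀ G ∈ channelMenus I J₀ w₁ w₂, NoSmallPathSumSubcoreExact I r y J₀ c G ∧ NoShortCoincidence I J₀ c G

/-- The restricted node is weaker than `MenuCriterionBound`. -/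
theorem menuCriterionBoundSlackTwo_of_menuCriterionBound (h : MenuCriterionBound) : MenuCriterionBoundSlackTwo :=
  fun n m r I hI hT hS hB y J₀ w₁ w₂ ht hc hcov hanc hN2 _ => h n m r I hI hT hS hB y J₀ w₁ w₂ ht hc hcov hanc hN2

/-- **THE CORE BOUND FROM O2 AND THE NODE PAST SLACK ONE** — the strong induction of `PstarMenuCriterion.terminalFive_of_menuBound`, the X-connected
structures of slack `0` and `1` being excluded by `no_centre_at_slack_zero` / `no_centre_at_slack_one`. -/
theorem terminalFive_of_menuBoundSlackTwo (hO2 : TerminalFiveA) (hb : MenuCriterionBoundSlackTwo) : TerminalFive := by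
  classical
  suffices H : ∀ (k n m r : ℕ) (I : LocalMap 4 n m), I.IsPure xorAndPred → Typed I → SimpleOverlap I → BoundaryExpanding r I →
      ∀ (y : Fin m → Bool) (J₀ : Finset (Fin m)) (w₁ w₂ : Finset (Fin n) × Finset (Fin m) × Bool), Terminal I r y J₀ w₁ w₂ →
        J₀.card = k → J₀.card ≤ 5 from
    fun n m r I hI hT hS hB y J₀ w₁ w₂ ht => H _ n m r I hI hT hS hB y J₀ w₁ w₂ ht rfl
  intro k
  induction k using Nat.strong_induction_on with
  | _ k ih =>
    intro n m r I hI hT hS hB y J₀ w₁ w₂ ht hk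
    by_cases hP : PstarChordBridgeCotree.Peelable I (nonchords I J₀)
    · obtain ⟨F, hS₀F, hFJ, hPF, hmax⟩ := exists_maximal_peelable_sup I (nonchords_subset I J₀) hP
      refine hO2 n m r I hI hT hS hB y J₀ w₁ w₂ ht F hFJ hPF hmax fun e he => ?_
      rw [mem_sdiff] at he
      by_contra hc
      exact he.2 (hS₀F ((mem_nonchords I).2 ⟨he.1, hc⟩))
    · exfalso
      obtain ⟨S, hSJ, hne, hL, hnc⟩ := exists_centre_of_not_peelable I hP
      have hdisj : Disjoint J₀ (w₁.2.1 ∪ w₂.2.1) := disjoint_union_right.2 ⟨ht.2.2.2.1, ht.2.2.2.2.1⟩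
      set 𝒢 := w₁.2.1 ∪ w₂.2.1 with h𝒢
      have hIH : ∀ c ∈ J₀, ∀ K₀ ⊆ J₀.erase c, ∀ d₁ d₂ : Finset (Fin n) × Finset (Fin m) × Bool, Terminal I r y K₀ d₁ d₂ → K₀.card ≤ 5 := by
        intro c hc K₀ hK₀ d₁ d₂ ht₀
        have hlt : K₀.card < k := by
          rw [← hk]
          exact lt_of_le_of_lt (card_le_card hK₀) (card_erase_lt_of_mem hc)
        exact ih K₀.card hlt n m r I hI hT hS hB y K₀ d₁ d₂ ht₀ rfl
      -- the slack layers `0` and `1` of X-connected cores carry no centre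
      have hslack : XConnected I J₀ → 3 * J₀.card + 2 ≤ 2 * (bdry I J₀).card := by
        intro hconn
        have hexp : 3 * J₀.card ≤ 2 * (bdry I J₀).card := hB J₀ ht.2.2.1.le
        by_contra hlt
        push Not at hlt
        by_cases h0 : 2 * (bdry I J₀).card = 3 * J₀.card
        · exact no_centre_at_slack_zero hI hT hS hB ht hIH hconn h0 ⟨S, hSJ, hne, hL, hnc⟩
        · exact no_centre_at_slack_one hI hT hS hB ht hIH hconn (by omega) ⟨S, hSJ, hne, hL, hnc⟩
      have hN2 : NoTwoCrossings I J₀ 𝒢 := fun W e₁ e₂ he₁ he₂ hne hc₁ hc₂ hcut =>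
        false_of_cleanCut_two hI hT hS hB ht hIH hcut he₁ he₂ hne hc₁ hc₂
      obtain ⟨ℬ, -, hℬ, hgood⟩ := hb n m r I hI hT hS hB y J₀ w₁ w₂ ht ⟨S, hSJ, hne, hL, hnc⟩ (covered_of_terminal hI hT hS hB ht)
        (anchored_of_terminal hI hT hS hB ht) hN2 hslack
      obtain ⟨𝒞, h𝒞J, hch, hO, hcard⟩ := exists_clean_chords hB ht
      have hU : 1 < (𝒞 \ ℬ).card := by
        have := le_card_sdiff ℬ 𝒞
        omega
      obtain ⟨a, ha, b, hb', hab⟩ := one_lt_card.1 hU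
      obtain ⟨ha𝒞, haℬ⟩ := mem_sdiff.1 ha
      obtain ⟨hb𝒞, hbℬ⟩ := mem_sdiff.1 hb'
      have hcrit : ∀ c ∈ 𝒞, c ∉ ℬ → ∀ G ∈ channelMenus I J₀ w₁ w₂,
          NoSmallPathSumSubcoreExact I r y J₀ c G ∧ NoShortCoincidence I J₀ c G := by
        intro c hc hcℬ G hG
        by_cases hsk : SkConnected I J₀ 𝒢 c
        · exact hgood c (h𝒞J hc) hcℬ (hch c hc) (hO c hc) hsk G hG
        · unfold PstarCleanCutAssembly.SkConnected at hsk
          push Not at hsk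
          obtain ⟨W, hcW, hcut⟩ := hsk
          obtain ⟨hA, hBc⟩ := smallCriterion_of_crossing (y := y) (r := r) hI hT hS hB hdisj (fun f hf hcf => hcut f hf hcf) hcW
          exact ⟨noSmallPathSumSubcoreExact_of_subset hA (subset_of_mem_channelMenus hG),
            noShortCoincidence_anti hBc (subset_of_mem_channelMenus hG)⟩
      have hgen : ∀ c ∈ 𝒞, c ∉ ℬ → MenuGeneric I y J₀ c w₁ w₂ := fun c hc hcℬ =>
        menuGeneric_of_criterion hI hT hS hB ht (h𝒞J hc) (hIH c (h𝒞J hc)) (hcrit c hc hcℬ)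
      exact false_of_two_clean_exact hI hT hS hB ht (h𝒞J ha𝒞) (h𝒞J hb𝒞) hab (hch a ha𝒞) (hch b hb𝒞) (hO a ha𝒞) (hO b hb𝒞)
        (hgen a ha𝒞 haℬ) (hgen b hb𝒞 hbℬ)

/-- **O1 from the same inputs.** -/
theorem terminalPeelable_of_menuBoundSlackTwo (hO2 : TerminalFiveA) (hb : MenuCriterionBoundSlackTwo) : TerminalPeelable :=
  terminalPeelable_of_terminalFive (terminalFive_of_menuBoundSlackTwo hO2 hb)

end Summit.PneNP.PneNP.Theorems.PstarSlackAssembly
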